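import Literature.AlgebraicGeometry.Resolution.DerivativeIdealsLocalization
import Mathlib.Algebra.MvPolynomial.PDeriv
import Mathlib.RingTheory.MvPolynomial.Ideal
import Mathlib.Algebra.CharP.Basic
import HarnessLib

/-!
# Coordinates with dual derivations, and BGMW Lemma 3.5.2 with equality

Topic: `Literature/AlgebraicGeometry/Resolution`. Bierstone–Grigoriev–Milman–Włodarczyk,
*Effective Hironaka resolution and its complexity*, arXiv:1206.3090, §3.5: "The dual sheaf of
derivations `Der_K(𝒪_X)` is locally generated by the derivations `∂/∂uᵢ`", `u_1, …, u_n` local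
coordinates; **Lemma 3.5.2**: "For any `i ≤ μ - 1`, `supp(𝓘, μ) = supp(𝒟ⁱ(𝓘), μ - i)`" — in
characteristic `p` under the standing hypothesis of §8, Thm. 8.0.4, that "the multiplicity `μ`
of all marked ideals is less than characteristic `p`".

PROVED here at the level of a ring `A` (think `𝒪_{X,x}`) with an ideal `𝔪` (think `𝔪_x`)
carrying a **coordinate system with dual derivations** (`CoordSystem R 𝔪 ι`: generators
`u : ι → A` of `𝔪` and `R`-derivations `δᵢ` with `δᵢ(u_j) = δ_{ij}`):

* `CoordSystem.euler_sub_mem_sq`, `CoordSystem.euler_sub_mul_mem_pow_succ` — the **Euler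
  congruence** `Σᵢ uᵢ δᵢ(f) ≡ s·f (mod 𝔪ˢ⁺¹)` for `f ∈ 𝔪ˢ` (Leibniz only; no regularity needed);
* `CoordSystem.exists_deriv_not_mem_pow` — if `s` is a unit of `A`, `f ∈ 𝔪ˢ ∖ 𝔪ˢ⁺¹ ⇒ δᵢ f ∉ 𝔪ˢ`
  for some `i`: **a derivative lowers the order by exactly one**;
* `CoordSystem.derivIdeal_not_le_pow`, `CoordSystem.derivIdealIter_not_le_pow` — hence
  `ord 𝒟ⁱ(I) = ord I - i` for `i ≤ ord I` when `1, …, ord I` are units;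
* `CoordSystem.derivIdealIter_not_le_pow_of_not_le_pow` — **Lemma 3.5.2, `⊇`**: if
  `1, …, μ - 1` are units in `A` then `I ⊄ 𝔪^μ ⇒ 𝒟ⁱ(I) ⊄ 𝔪^{μ-i}` for all `i < μ` (with the
  unconditional `⊆` of `DerivativeIdeals.lean`: `ord I ≥ μ ⇔ ord 𝒟ⁱ(I) ≥ μ - i`);
* `CoordSystem.mvPolynomial` — the coordinates `xᵢ - aᵢ` and `∂/∂xᵢ` at a point `a ∈ 𝔸ⁿ(R)`;
  `CoordSystem.exists_map_of_isLocalization` — coordinate systems pass to localizations (so to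
  the local rings `𝒪_{𝔸ⁿ,a}`); `CoordSystem.exists_map_algEquiv` — and along algebra
  isomorphisms; `CoordSystem.copy`;
* `isUnit_natCast_of_pos_of_lt` — over a field of characteristic `p`, `0 < j < p` (or `p = 0`)
  makes `j` a unit in every algebra: the form in which "`μ < p`" (here even `μ ≤ p`) enters.

## Sources

* [BGMW 2011] §3.5, Def. 3.5.1, Lemma 3.5.2; §8 Thm. 8.0.4 (arXiv numbering).
  [BierstoneGrigorievMilmanWlodarczyk2011]
-/

namespace Literature.AlgebraicGeometry.Resolution

open scoped BigOperators

universe u v w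

/-! ## Coordinate systems with dual derivations -/

/-- A **coordinate system with dual derivations** for the ideal `𝔪` of the `R`-algebra `A`:
generators `u_i` (`i ∈ ι`) of `𝔪` and `R`-derivations `δ_i = "∂/∂u_i"` of `A` with
`δ_i(u_j) = δ_{ij}` (BGMW §3.5: local coordinates `u_1, …, u_n` on a smooth variety and the
dual derivations `∂/∂u_i` generating `Der_K(𝒪_X)`; here only the duality is recorded).
[cite: BierstoneGrigorievMilmanWlodarczyk2011, §3.5] -/
structure CoordSystem (R : Type u) {A : Type v} [CommSemiring R] [CommRing A] [Algebra R A]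
    (𝔪 : Ideal A) (ι : Type w) where
  /-- the coordinates `u_i`, generating `𝔪` -/
  coord : ι → A
  /-- the dual derivations `δ_i = ∂/∂u_i` -/
  deriv : ι → Derivation R A A
  /-- the `u_i` generate `𝔪` -/
  span_range_coord : Ideal.span (Set.range coord) = 𝔪
  /-- duality `δ_i(u_i) = 1` -/
  deriv_coord_self : ∀ i, deriv i (coord i) = 1
  /-- duality `δ_i(u_j) = 0` for `i ≠ j` -/
  deriv_coord_of_ne : ∀ i j, i ≠ j → deriv i (coord j) = 0

namespace CoordSystem

section Ring

variable {R : Type u} {A : Type v} [CommSemiring R] [CommRing A] [Algebra R A] {𝔪 : Ideal A}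
  {ι : Type w}

/-- The coordinates lie in `𝔪`. [folklore] -/
theorem coord_mem (c : CoordSystem R 𝔪 ι) (i : ι) : c.coord i ∈ 𝔪 :=
  c.span_range_coord.le (Ideal.subset_span ⟨i, rfl⟩)

/-- `Σ_i u_i g_i ∈ 𝔪 · J` whenever all `g_i ∈ J`; in particular `Σ_i u_i δ_i(f) ∈ 𝔪`. [folklore] -/
theorem sum_coord_mul_mem (c : CoordSystem R 𝔪 ι) (s : Finset ι) {J : Ideal A} {g : ι → A}
    (hg : ∀ i ∈ s, g i ∈ J) : ∑ i ∈ s, c.coord i * g i ∈ 𝔪 * J :=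
  sum_mem fun i hi => Ideal.mul_mem_mul (c.coord_mem i) (hg i hi)

/-- Transport along an equality of ideals. [folklore] -/
def copy (c : CoordSystem R 𝔪 ι) {𝔪' : Ideal A} (h : 𝔪 = 𝔪') : CoordSystem R 𝔪' ι :=
  ⟨c.coord, c.deriv, c.span_range_coord.trans h, c.deriv_coord_self, c.deriv_coord_of_ne⟩

/-- Unfolding `copy`. [folklore] -/
@[simp] theorem copy_coord (c : CoordSystem R 𝔪 ι) {𝔪' : Ideal A} (h : 𝔪 = 𝔪') :
    (c.copy h).coord = c.coord := rfl

/-- Unfolding `copy`. [folklore] -/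
@[simp] theorem copy_deriv (c : CoordSystem R 𝔪 ι) {𝔪' : Ideal A} (h : 𝔪 = 𝔪') :
    (c.copy h).deriv = c.deriv := rfl

variable [Fintype ι]

/-- `Σ_i u_i δ_i(u_j) = u_j`. [folklore] -/
theorem sum_coord_mul_deriv_coord (c : CoordSystem R 𝔪 ι) (j : ι) :
    ∑ i, c.coord i * c.deriv i (c.coord j) = c.coord j := by
  rw [Finset.sum_eq_single j (fun i _ hij => by rw [c.deriv_coord_of_ne i j hij, mul_zero])
    (fun h => absurd (Finset.mem_univ j) h), c.deriv_coord_self, mul_one]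

/-- Leibniz for the Euler operator: `Σ_i u_i δ_i(ab) = a Σ_i u_i δ_i(b) + b Σ_i u_i δ_i(a)`.
[folklore] -/
theorem sum_coord_mul_deriv_mul (c : CoordSystem R 𝔪 ι) (a b : A) :
    ∑ i, c.coord i * c.deriv i (a * b) =
      a * ∑ i, c.coord i * c.deriv i b + b * ∑ i, c.coord i * c.deriv i a := by
  rw [Finset.mul_sum, Finset.mul_sum, ← Finset.sum_add_distrib]
  refine Finset.sum_congr rfl fun i _ => ?_
  rw [Derivation.leibniz, smul_eq_mul, smul_eq_mul]
  ring

/-- **Euler congruence, degree one**: `Σ_i u_i δ_i(a) ≡ a (mod 𝔪²)` for `a ∈ 𝔪`. [folklore] -/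
theorem euler_sub_mem_sq (c : CoordSystem R 𝔪 ι) {a : A} (ha : a ∈ 𝔪) :
    (∑ i, c.coord i * c.deriv i a) - a ∈ 𝔪 ^ 2 := by
  rw [← c.span_range_coord] at ha
  refine Submodule.span_induction (p := fun a _ => (∑ i, c.coord i * c.deriv i a) - a ∈ 𝔪 ^ 2)
    ?_ ?_ ?_ ?_ ha
  · rintro _ ⟨j, rfl⟩
    rw [c.sum_coord_mul_deriv_coord, sub_self]
    exact zero_mem _
  · simp
  · intro x y _ _ hx hy
    have : (∑ i, c.coord i * c.deriv i (x + y)) - (x + y) =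
        ((∑ i, c.coord i * c.deriv i x) - x) + ((∑ i, c.coord i * c.deriv i y) - y) := by
      simp only [map_add, mul_add, Finset.sum_add_distrib]
      ring
    rw [this]
    exact add_mem hx hy
  · intro r x hx' hx
    have hxm : x ∈ 𝔪 := c.span_range_coord ▸ hx'
    have : (∑ i, c.coord i * c.deriv i (r • x)) - r • x =
        r * ((∑ i, c.coord i * c.deriv i x) - x) + x * ∑ i, c.coord i * c.deriv i r := by
      rw [smul_eq_mul, c.sum_coord_mul_deriv_mul]
      ring
    rw [this, pow_two]
    refine add_mem (Ideal.mul_mem_left _ _ (pow_two 𝔪 ▸ hx)) (Ideal.mul_mem_mul hxm ?_)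
    exact Ideal.mul_le_right (c.sum_coord_mul_mem Finset.univ fun i _ => Submodule.mem_top)

/-- **Euler congruence**: `Σ_i u_i δ_i(f) ≡ s · f (mod 𝔪ˢ⁺¹)` for `f ∈ 𝔪ˢ` (by induction on
`s`, Leibniz, and the degree-one case). [folklore] -/
theorem euler_sub_mul_mem_pow_succ (c : CoordSystem R 𝔪 ι) (s : ℕ) {f : A} (hf : f ∈ 𝔪 ^ s) :
    (∑ i, c.coord i * c.deriv i f) - s * f ∈ 𝔪 ^ (s + 1) := by
  induction s generalizing f with
  | zero =>
    rw [Nat.cast_zero, zero_mul, sub_zero, zero_add, pow_one]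
    exact sum_mem fun i _ => Ideal.mul_mem_right _ _ (c.coord_mem i)
  | succ s ih =>
    rw [pow_succ'] at hf
    refine Submodule.mul_induction_on hf (fun a ha b hb => ?_) (fun x y hx hy => ?_)
    · have : (∑ i, c.coord i * c.deriv i (a * b)) - ((s + 1 : ℕ) : A) * (a * b) =
          a * ((∑ i, c.coord i * c.deriv i b) - s * b) +
            b * ((∑ i, c.coord i * c.deriv i a) - a) := by
        rw [c.sum_coord_mul_deriv_mul]; push_cast; ring
      rw [this]
      refine add_mem ?_ ?_
      · rw [show s + 1 + 1 = 1 + (s + 1) by ring, pow_add, pow_one]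
        exact Ideal.mul_mem_mul ha (ih hb)
      · rw [show s + 1 + 1 = s + 2 by ring, pow_add]
        exact Ideal.mul_mem_mul hb (c.euler_sub_mem_sq ha)
    · have : (∑ i, c.coord i * c.deriv i (x + y)) - ((s + 1 : ℕ) : A) * (x + y) =
          ((∑ i, c.coord i * c.deriv i x) - ((s + 1 : ℕ) : A) * x) +
            ((∑ i, c.coord i * c.deriv i y) - ((s + 1 : ℕ) : A) * y) := by
        simp only [map_add, mul_add, Finset.sum_add_distrib]
        ring
      rw [this]
      exact add_mem hx hy

/-- **A derivative lowers the order by exactly one**: if `s` is a unit of `A` and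
`f ∈ 𝔪ˢ ∖ 𝔪ˢ⁺¹`, then `δ_i(f) ∉ 𝔪ˢ` for some coordinate derivation `δ_i` (else
`s f ≡ Σ u_i δ_i f ∈ 𝔪ˢ⁺¹`). [cite: BierstoneGrigorievMilmanWlodarczyk2011, Lemma 3.5.2] -/
theorem exists_deriv_not_mem_pow (c : CoordSystem R 𝔪 ι) {s : ℕ} (hs : IsUnit (s : A)) {f : A}
    (hf : f ∈ 𝔪 ^ s) (hf' : f ∉ 𝔪 ^ (s + 1)) : ∃ i, c.deriv i f ∉ 𝔪 ^ s := by
  by_contra h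
  push Not at h
  have hsum : (∑ i, c.coord i * c.deriv i f) ∈ 𝔪 ^ (s + 1) := by
    rw [pow_succ']
    exact sum_mem fun i _ => Ideal.mul_mem_mul (c.coord_mem i) (h i)
  have hsf : (s : A) * f ∈ 𝔪 ^ (s + 1) := by
    have := sub_mem hsum (c.euler_sub_mul_mem_pow_succ s hf)
    rwa [sub_sub_cancel] at this
  obtain ⟨v, hv⟩ := hs
  apply hf'
  have : f = (↑v⁻¹ : A) * ((s : A) * f) := by
    rw [← hv, ← mul_assoc, Units.inv_mul, one_mul]
  rw [this]
  exact Ideal.mul_mem_left _ _ hsf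

/-- Ideal form: `I ⊆ 𝔪ˢ`, `I ⊄ 𝔪ˢ⁺¹`, `s` a unit `⇒ 𝒟(I) ⊄ 𝔪ˢ` (and `𝒟(I) ⊆ 𝔪ˢ⁻¹`,
`derivIdeal_le_pow_sub_one`): `ord 𝒟(I) = ord I - 1`.
[cite: BierstoneGrigorievMilmanWlodarczyk2011, Lemma 3.5.2] -/
theorem derivIdeal_not_le_pow (c : CoordSystem R 𝔪 ι) {s : ℕ} (hs : IsUnit (s : A)) {I : Ideal A}
    (hI : I ≤ 𝔪 ^ s) (hI' : ¬I ≤ 𝔪 ^ (s + 1)) : ¬derivIdeal R I ≤ 𝔪 ^ s := by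
  intro h
  obtain ⟨f, hfI, hf'⟩ := Set.not_subset.mp hI'
  obtain ⟨i, hi⟩ := c.exists_deriv_not_mem_pow hs (hI hfI) hf'
  exact hi (h (apply_mem_derivIdeal R (c.deriv i) hfI))

/-- Iterated: if `1, …, s` are units, `I ⊆ 𝔪ˢ`, `I ⊄ 𝔪ˢ⁺¹`, then `𝒟ⁱ(I) ⊄ 𝔪^{s-i+1}` for all
`i ≤ s` (with `𝒟ⁱ(I) ⊆ 𝔪^{s-i}`: `ord 𝒟ⁱ(I) = ord I - i`).
[cite: BierstoneGrigorievMilmanWlodarczyk2011, Lemma 3.5.2] -/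
theorem derivIdealIter_not_le_pow (c : CoordSystem R 𝔪 ι) {s : ℕ}
    (hunit : ∀ j : ℕ, 0 < j → j ≤ s → IsUnit (j : A)) {I : Ideal A}
    (hI : I ≤ 𝔪 ^ s) (hI' : ¬I ≤ 𝔪 ^ (s + 1)) :
    ∀ i ≤ s, ¬derivIdealIter R i I ≤ 𝔪 ^ (s - i + 1) := by
  intro i
  induction i with
  | zero => intro _; simpa using hI'
  | succ i ih =>
    intro hi
    have hi' : i ≤ s := Nat.le_of_succ_le hi
    have h1 : derivIdealIter R i I ≤ 𝔪 ^ (s - i) := derivIdealIter_le_pow_sub R hI i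
    have h2 : ¬derivIdealIter R i I ≤ 𝔪 ^ (s - i + 1) := ih hi'
    have hsub : s - (i + 1) + 1 = s - i := by omega
    rw [derivIdealIter_succ, hsub]
    exact c.derivIdeal_not_le_pow (hunit (s - i) (by omega) (Nat.sub_le s i)) h1 h2

/-- **BGMW Lemma 3.5.2, the inclusion `supp(𝒟ⁱ(𝓘), μ - i) ⊆ supp(𝓘, μ)` (`i ≤ μ - 1`)**, ring
form at a point with coordinates: if `1, …, μ - 1` are units of `A` (characteristic zero, or
`μ ≤ p`), then `I ⊄ 𝔪^μ ⇒ 𝒟ⁱ(I) ⊄ 𝔪^{μ - i}` for every `i < μ`.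
[cite: BierstoneGrigorievMilmanWlodarczyk2011, Lemma 3.5.2] -/
theorem derivIdealIter_not_le_pow_of_not_le_pow (c : CoordSystem R 𝔪 ι) {μ : ℕ}
    (hunit : ∀ j : ℕ, 0 < j → j < μ → IsUnit (j : A)) {I : Ideal A} (hI : ¬I ≤ 𝔪 ^ μ)
    {i : ℕ} (hi : i < μ) : ¬derivIdealIter R i I ≤ 𝔪 ^ (μ - i) := by
  classical
  -- the order `s` of `I`: minimal with `I ⊄ 𝔪ˢ⁺¹`
  have hex : ∃ t : ℕ, ¬I ≤ 𝔪 ^ (t + 1) := ⟨μ - 1, by rwa [Nat.sub_add_cancel (by omega)]⟩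
  set s := Nat.find hex with hs
  have hs' : ¬I ≤ 𝔪 ^ (s + 1) := Nat.find_spec hex
  have hsμ : s ≤ μ - 1 := Nat.find_min' hex (by rwa [Nat.sub_add_cancel (by omega)])
  have hIs : I ≤ 𝔪 ^ s := by
    rcases Nat.eq_zero_or_eq_succ_pred s with h0 | hsucc
    · rw [h0, pow_zero, Ideal.one_eq_top]; exact le_top
    · have := Nat.find_min hex (show s - 1 < s by omega)
      push Not at this
      rwa [Nat.sub_add_cancel (by omega)] at this
  have hunit' : ∀ j : ℕ, 0 < j → j ≤ s → IsUnit (j : A) :=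
    fun j hj hjs => hunit j hj (by omega)
  intro h
  rcases le_or_gt i s with his | his
  · -- `𝒟ⁱ(I) ⊄ 𝔪^{s-i+1} ⊇ 𝔪^{μ-i}`
    refine c.derivIdealIter_not_le_pow hunit' hIs hs' i his (h.trans ?_)
    exact Ideal.pow_le_pow_right (by omega)
  · -- `𝒟ˢ(I) ⊄ 𝔪`, but `𝒟ˢ(I) ⊆ 𝒟ⁱ(I) ⊆ 𝔪^{μ-i} ⊆ 𝔪`
    refine c.derivIdealIter_not_le_pow hunit' hIs hs' s le_rfl ?_
    rw [Nat.sub_self, zero_add, pow_one]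
    calc derivIdealIter R s I ≤ derivIdealIter R i I := derivIdealIter_le_derivIdealIter R his.le I
      _ ≤ 𝔪 ^ (μ - i) := h
      _ ≤ 𝔪 := Ideal.pow_le_self (by omega)

/-- With the unconditional inclusion: under the same hypotheses, for `i < μ`,
**`I ⊆ 𝔪^μ ⇔ 𝒟ⁱ(I) ⊆ 𝔪^{μ-i}`** (`ord_x 𝓘 ≥ μ ⇔ ord_x 𝒟ⁱ(𝓘) ≥ μ - i`, BGMW Lemma 3.5.2 at a
point). [cite: BierstoneGrigorievMilmanWlodarczyk2011, Lemma 3.5.2] -/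
theorem le_pow_iff_derivIdealIter_le_pow (c : CoordSystem R 𝔪 ι) {μ : ℕ}
    (hunit : ∀ j : ℕ, 0 < j → j < μ → IsUnit (j : A)) (I : Ideal A) {i : ℕ} (hi : i < μ) :
    I ≤ 𝔪 ^ μ ↔ derivIdealIter R i I ≤ 𝔪 ^ (μ - i) :=
  ⟨fun h => derivIdealIter_le_pow_sub R h i,
    fun h => by_contra fun hI => c.derivIdealIter_not_le_pow_of_not_le_pow hunit hI hi h⟩

end Ring

/-! ## Examples: affine space; localizations -/

section Examples

/-- **Coordinates at a point `a ∈ 𝔸ⁿ(R)`**: `u_i = x_i - a_i` generate the ideal of `a`, with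
dual derivations `∂/∂x_i`. [cite: BierstoneGrigorievMilmanWlodarczyk2011, §3.5] -/
noncomputable def mvPolynomial (R : Type u) [CommRing R] (σ : Type w) (a : σ → R) :
    CoordSystem R (Ideal.span (Set.range fun i : σ => MvPolynomial.X i - MvPolynomial.C (a i))) σ where
  coord i := MvPolynomial.X i - MvPolynomial.C (a i)
  deriv i := MvPolynomial.pderiv i
  span_range_coord := rfl
  deriv_coord_self i := by
    rw [map_sub, MvPolynomial.pderiv_C, sub_zero, MvPolynomial.pderiv_X_self]
  deriv_coord_of_ne i j h := by
    rw [map_sub, MvPolynomial.pderiv_C, sub_zero, MvPolynomial.pderiv_X_of_ne (Ne.symm h)]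

/-- At the origin: `u_i = x_i`, `𝔪 = (x_i : i ∈ σ)` (`MvPolynomial.idealOfVars`).
[cite: BierstoneGrigorievMilmanWlodarczyk2011, §3.5] -/
noncomputable def mvPolynomialOrigin (R : Type u) [CommRing R] (σ : Type w) :
    CoordSystem R (MvPolynomial.idealOfVars σ R) σ :=
  (mvPolynomial R σ 0).copy (by simp [MvPolynomial.idealOfVars])

variable {R : Type u} {A : Type v} [CommRing R] [CommRing A] [Algebra R A] {𝔪 : Ideal A}
  {ι : Type w}

/-- **Coordinate systems localize**: a coordinate system for `𝔪 ⊆ A` induces one for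
`𝔪·S` in every localization `S = M⁻¹A` (the derivations extend,
`exists_derivation_extend_of_isLocalization`) — in particular for the maximal ideal
`𝔪 A_𝔪` of the local ring at a point. [folklore] -/
theorem exists_map_of_isLocalization (c : CoordSystem R 𝔪 ι) (S : Type*) [CommRing S]
    [Algebra A S] [Algebra R S] [IsScalarTower R A S] (M : Submonoid A) [IsLocalization M S] :
    ∃ c' : CoordSystem R (𝔪.map (algebraMap A S)) ι,
      ∀ i, c'.coord i = algebraMap A S (c.coord i) := by
  choose δ' hδ' using fun i => exists_derivation_extend_of_isLocalization R S M (c.deriv i)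
  refine ⟨⟨fun i => algebraMap A S (c.coord i), δ', ?_, fun i => ?_, fun i j h => ?_⟩,
    fun i => rfl⟩
  · have h := congrArg (Ideal.map (algebraMap A S)) c.span_range_coord
    rw [Ideal.map_span, ← Set.range_comp] at h
    exact h
  · rw [hδ', c.deriv_coord_self, map_one]
  · rw [hδ', c.deriv_coord_of_ne i j h, map_zero]

/-- **Coordinate systems transport along algebra isomorphisms** `e : A ≃ₐ[R] B` (the
derivations conjugate: `δ ↦ e ∘ δ ∘ e⁻¹`). [folklore] -/
theorem exists_map_algEquiv (c : CoordSystem R 𝔪 ι) {B : Type*} [CommRing B] [Algebra R B]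
    (e : A ≃ₐ[R] B) :
    ∃ c' : CoordSystem R (𝔪.map (e : A →+* B)) ι, ∀ i, c'.coord i = e (c.coord i) := by
  -- the conjugate derivations
  let δ' : ι → Derivation R B B := fun i =>
    { toLinearMap := (e : A →ₗ[R] B) ∘ₗ (c.deriv i : A →ₗ[R] A) ∘ₗ (e.symm : B →ₗ[R] A)
      map_one_eq_zero' := by simp
      leibniz' := fun a b => by
        change e (c.deriv i (e.symm (a * b))) =
          a • e (c.deriv i (e.symm b)) + b • e (c.deriv i (e.symm a))
        rw [map_mul, Derivation.leibniz, map_add, smul_eq_mul, smul_eq_mul, map_mul, map_mul,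
          e.apply_symm_apply, e.apply_symm_apply, smul_eq_mul, smul_eq_mul] }
  have hδ' : ∀ i (a : A), δ' i (e a) = e (c.deriv i a) := fun i a => by
    change e (c.deriv i (e.symm (e a))) = e (c.deriv i a)
    rw [e.symm_apply_apply]
  refine ⟨⟨fun i => e (c.coord i), δ', ?_, fun i => ?_, fun i j h => ?_⟩, fun i => rfl⟩
  · have h := congrArg (Ideal.map (e : A →+* B)) c.span_range_coord
    rw [Ideal.map_span, ← Set.range_comp] at h
    exact h
  · rw [hδ', c.deriv_coord_self, map_one]
  · rw [hδ', c.deriv_coord_of_ne i j h, map_zero]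

end Examples

end CoordSystem

/-! ## The characteristic hypothesis: `1, …, μ - 1` are units when `μ ≤ p` -/

/-- Over a field `k` of characteristic `p`, a positive integer `j` with `j < p` (or any positive
`j` if `p = 0`) is a unit in every `k`-algebra — the form in which BGMW's hypothesis
"multiplicity `< p`" (§8, Thm. 8.0.4) is used. [cite: BierstoneGrigorievMilmanWlodarczyk2011, Thm. 8.0.4] -/
theorem isUnit_natCast_of_pos_of_lt {k : Type u} [Field k] (p : ℕ) [CharP k p] {A : Type v}
    [CommRing A] [Algebra k A] {j : ℕ} (hj : 0 < j) (hjp : p = 0 ∨ j < p) :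
    IsUnit (j : A) := by
  have hk : (j : k) ≠ 0 := by
    intro h
    rw [CharP.cast_eq_zero_iff k p] at h
    rcases hjp with hp | hjp
    · rw [hp, zero_dvd_iff] at h; omega
    · exact Nat.not_dvd_of_pos_of_lt hj hjp h
  have := (IsUnit.mk0 _ hk).map (algebraMap k A)
  rwa [map_natCast] at this

end Literature.AlgebraicGeometry.Resolution
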